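import Summits.AtomisticToContinuum.BoseEinsteinCondensation.Theorems.BECSwapNoCatastropheDefs
import HarnessLib

/-!
# Crux `TorusHalfSwapOverlap` (stmt-AtomisticToContinuum-14393), line `birth`, stub `stub_lowerFrame` (S6a)

Route `BECSwapNoCatastrophe` (sub-problem `BoseEinsteinCondensation`), lead c6 (2026-08-17). ENERGY ORDERING
OF THE HALF-SWAP FRAMES — the LOWER frame, at fixed `n`, for every repulsive finite-range `v` (hard cores
`v = ⊤` on a set included): on the absolute admissible class `Adm0` of the two-copy torus of side `L` the
half-swapped form is bounded below by twice the one-copy bosonic ground-state energy,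
`2 · E₀^per(n+1, L) ≤ E2(½)(Θ)` (folded `TwoCopyTorus` vocabulary of
`Theorems/BECSwapNoCatastropheDefs.lean`).

Proof. Everything is in `ℝ≥0∞` (no subtraction, no measurability of `v`). Pointwise on
`(ℝ³)^{n+1} × (ℝ³)^{n+1}` the `E2(½)`-integrand of `Θ` at `Z` is the average `2⁻¹ · A Z + 2⁻¹ · B Z`
of the `E2(0)`-integrand `A Z = kinetic2 Θ Z + W₀ Z · |Θ Z|²`, where
`W₀ (X, Y) = ∑_{i<j} v^per(xᵢ - xⱼ) + ∑_{i<j} v^per(yᵢ - yⱼ)`, and of its weight-swapped twin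
`B Z = kinetic2 Θ Z + W₀ (F Z) · |Θ Z|²` (`F` the one-pair swap `swapF`): indeed
`w_½ = 2⁻¹ · W₀ + 2⁻¹ · (W₀ ∘ F)` by splitting the two pair sums at the tags
(`periodicInteraction_succ`). Hence `E2(½)(Θ) ≥ 2⁻¹ ∫ A + 2⁻¹ ∫ B` (`le_lintegral_add`,
`lintegral_const_mul'`), where `∫ A = E2(0)(Θ) ≥ 2 E₀` (`TwoCopyTorus.productLower`) and — changing
variables under the measure-preserving involution `F` of the cell
(`SwapInvariance.setLIntegral_comp_swap`) with the kinetic chain rule `SwapInvariance.kinetic_comp` —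
`∫ B = E2(0)(Θ ∘ F) ≥ 2 E₀` (`TwoCopyTorus.productLower` for `Θ ∘ F ∈ Adm0`,
`TwoCopyTorus.swapInvariance`). Finally `2⁻¹ · 2E₀ + 2⁻¹ · 2E₀ = 2E₀`. [folklore]
-/

noncomputable section

open MeasureTheory Filter
open scoped ENNReal NNReal BigOperators

namespace Summit.AtomisticToContinuum.BoseEinsteinCondensation.Cruxes.TorusHalfSwapOverlap.Birth

open Literature.MathematicalPhysics.QuantumManyBody.BoseGas

/-! ### Helper lemmas (inside `namespace LowerFrame … end LowerFrame`) -/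

namespace LowerFrame

open Summit.AtomisticToContinuum.BoseEinsteinCondensation.TwoCopyTorus
  (swapF kinetic2 halfSwapWeight cell2 E2zero E2half E2half_eq)

variable {n : ℕ}

/-! #### Arithmetic in `ℝ≥0∞` -/

/-- `2⁻¹ · a + 2⁻¹ · a = a` in `ℝ≥0∞`. [folklore] -/
theorem inv_two_mul_add_self (a : ℝ≥0∞) : 2⁻¹ * a + 2⁻¹ * a = a := by
  rw [← add_mul, ENNReal.inv_two_add_inv_two, one_mul]

/-- `2⁻¹ ≠ ⊤` in `ℝ≥0∞`. [folklore] -/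
theorem two_inv_ne_top : (2 : ℝ≥0∞)⁻¹ ≠ ⊤ :=
  ENNReal.inv_ne_top.mpr two_ne_zero

/-- Averaging identity behind the frame: if `h + h = 1` then
`K + (h·W + h·W')·ρ = h·(K + W·ρ) + h·(K + W'·ρ)` (no subtraction). [folklore] -/
theorem avg_mul_add {h : ℝ≥0∞} (h2 : h + h = 1) (K W W' ρ : ℝ≥0∞) :
    K + (h * W + h * W') * ρ = h * (K + W * ρ) + h * (K + W' * ρ) := by
  calc K + (h * W + h * W') * ρ = (h + h) * K + (h * W + h * W') * ρ := by rw [h2, one_mul]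
    _ = h * (K + W * ρ) + h * (K + W' * ρ) := by ring

/-- Averaging identity for the weights: if `h + h = 1` then
`p₁ + p₂ + h·(A + B + C + D) = h·(A + p₁ + (B + p₂)) + h·(C + p₁ + (D + p₂))`. [folklore] -/
theorem avg_weights {h : ℝ≥0∞} (h2 : h + h = 1) (p₁ p₂ A B C D : ℝ≥0∞) :
    p₁ + p₂ + h * (A + B + C + D) = h * (A + p₁ + (B + p₂)) + h * (C + p₁ + (D + p₂)) := by
  calc p₁ + p₂ + h * (A + B + C + D)
        = (h + h) * p₁ + (h + h) * p₂ + h * (A + B + C + D) := by rw [h2, one_mul, one_mul]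
    _ = h * (A + p₁ + (B + p₂)) + h * (C + p₁ + (D + p₂)) := by ring

/-! #### The swap and the weights -/

/-- The one-pair swap is an involution, `F (F Z) = Z`. [folklore] -/
theorem swapF_swapF (Z : Config (n + 1) × Config (n + 1)) : swapF n (swapF n Z) = Z := by
  obtain ⟨X, Y⟩ := Z
  simp only [swapF, Matrix.cons_val_zero, SwapInvariance.tail_vecCons]
  exact Prod.ext (Fin.cons_self_tail X) (Fin.cons_self_tail Y)

/-- Splitting the pair interaction of `x :: U` at the tag:
`∑_{i<j} v^per(zᵢ - zⱼ) = ∑ⱼ v^per(x - uⱼ) + ∑_{i<j} v^per(uᵢ - uⱼ)` (`periodicInteraction_succ`). [folklore] -/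
theorem periodicInteraction_vecCons (v : ℝ → ℝ≥0∞) (L : ℝ) (x : Space) (U : Config n) :
    periodicInteraction v L (Matrix.vecCons x U : Config (n + 1)) =
      (∑ j : Fin n, periodizedPotential v L (x - U j)) + periodicInteraction v L U := by
  rw [periodicInteraction_succ]
  simp only [Matrix.cons_val_zero, Matrix.cons_val_succ, Matrix.tail_cons]

/-- **The half-swapped weight is the average of the uncoupled weight and its swap**:
`w_½ Z = 2⁻¹ · W₀ Z + 2⁻¹ · W₀ (F Z)` with `W₀ (X, Y) = ∑_{i<j} v^per(xᵢ - xⱼ) + ∑_{i<j} v^per(yᵢ - yⱼ)`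
(split both pair sums of `W₀` at the tags; `2⁻¹ · ⊤ = ⊤` allowed). [folklore] -/
theorem halfSwapWeight_eq (v : ℝ → ℝ≥0∞) (L : ℝ) (Z : Config (n + 1) × Config (n + 1)) :
    halfSwapWeight v n L Z =
      2⁻¹ * (periodicInteraction v L Z.1 + periodicInteraction v L Z.2) +
        2⁻¹ * (periodicInteraction v L (swapF n Z).1 + periodicInteraction v L (swapF n Z).2) := by
  rw [periodicInteraction_succ v L Z.1, periodicInteraction_succ v L Z.2]
  simp only [halfSwapWeight, swapF, periodicInteraction_vecCons, SwapInvariance.tail_apply,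
    show ∀ X : Config (n + 1), Matrix.vecTail X = Fin.tail X from fun _ => rfl,
    ← Finset.mul_sum, Finset.sum_add_distrib]
  exact avg_weights ENNReal.inv_two_add_inv_two _ _ _ _ _ _

/-! #### The pointwise identities of integrands -/

/-- **Pointwise, the `E2(½)` integrand is the average of the `E2(0)` integrand and its weight-swapped
twin.** [folklore] -/
theorem integrand_half_eq (v : ℝ → ℝ≥0∞) (L : ℝ) (Θ : Config (n + 1) × Config (n + 1) → ℂ)
    (Z : Config (n + 1) × Config (n + 1)) :
    kinetic2 n Θ Z + halfSwapWeight v n L Z * (‖Θ Z‖₊ : ℝ≥0∞) ^ 2 =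
      2⁻¹ * (kinetic2 n Θ Z +
          (periodicInteraction v L Z.1 + periodicInteraction v L Z.2) * (‖Θ Z‖₊ : ℝ≥0∞) ^ 2) +
        2⁻¹ * (kinetic2 n Θ Z +
          (periodicInteraction v L (swapF n Z).1 + periodicInteraction v L (swapF n Z).2) *
            (‖Θ Z‖₊ : ℝ≥0∞) ^ 2) := by
  rw [halfSwapWeight_eq]
  exact avg_mul_add ENNReal.inv_two_add_inv_two _ _ _ _

/-- **The `E2(0)` integrand of `Θ ∘ F` at `Z` is the weight-swapped twin integrand of `Θ` at `F Z`**
(kinetic chain rule `SwapInvariance.kinetic_comp`, and `F ∘ F = id` for the weight). [folklore] -/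
theorem integrand_zero_comp_swap (v : ℝ → ℝ≥0∞) (L : ℝ) {Θ : Config (n + 1) × Config (n + 1) → ℂ}
    (hΘ : Differentiable ℝ Θ) (Z : Config (n + 1) × Config (n + 1)) :
    kinetic2 n (fun W => Θ (swapF n W)) Z +
        (periodicInteraction v L Z.1 + periodicInteraction v L Z.2) *
          (‖Θ (swapF n Z)‖₊ : ℝ≥0∞) ^ 2 =
      kinetic2 n Θ (swapF n Z) +
        (periodicInteraction v L (swapF n (swapF n Z)).1 +
            periodicInteraction v L (swapF n (swapF n Z)).2) *
          (‖Θ (swapF n Z)‖₊ : ℝ≥0∞) ^ 2 := by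
  rw [swapF_swapF]
  congr 1
  obtain ⟨Fl, hFl⟩ := SwapInvariance.exists_clm n
  have hFl' : ∀ W, Fl W = swapF n W := hFl
  have key := SwapInvariance.kinetic_comp Fl hFl (Θ := Θ) (Φ := fun W => Θ (swapF n W))
    (fun W => by rw [hFl']) hΘ Z
  rw [hFl'] at key
  exact key

/-- **`E2(0)(Θ ∘ F)` is the integral of the weight-swapped twin integrand of `Θ`** (change of
variables `Z ↦ F Z` on the cell, `SwapInvariance.setLIntegral_comp_swap`). [folklore] -/
theorem E2zero_comp_swap (v : ℝ → ℝ≥0∞) (L : ℝ) {Θ : Config (n + 1) × Config (n + 1) → ℂ}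
    (hΘ : Differentiable ℝ Θ) :
    E2zero v n L (fun W => Θ (swapF n W)) =
      ∫⁻ Z in cell2 n L, (kinetic2 n Θ Z +
        (periodicInteraction v L (swapF n Z).1 + periodicInteraction v L (swapF n Z).2) *
          (‖Θ Z‖₊ : ℝ≥0∞) ^ 2) := by
  unfold E2zero cell2
  refine Eq.trans (lintegral_congr fun Z => integrand_zero_comp_swap v L hΘ Z) ?_
  exact SwapInvariance.setLIntegral_comp_swap n L (fun W => kinetic2 n Θ W +
    (periodicInteraction v L (swapF n W).1 + periodicInteraction v L (swapF n W).2) *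
      (‖Θ W‖₊ : ℝ≥0∞) ^ 2)

/-- **`E2(½)(Θ)` is the integral of the average of the two integrands.** [folklore] -/
theorem E2half_eq_lintegral_avg (v : ℝ → ℝ≥0∞) (L : ℝ) (Θ : Config (n + 1) × Config (n + 1) → ℂ) :
    E2half v n L Θ =
      ∫⁻ Z in cell2 n L,
        (2⁻¹ * (kinetic2 n Θ Z +
            (periodicInteraction v L Z.1 + periodicInteraction v L Z.2) * (‖Θ Z‖₊ : ℝ≥0∞) ^ 2) +
          2⁻¹ * (kinetic2 n Θ Z +
            (periodicInteraction v L (swapF n Z).1 + periodicInteraction v L (swapF n Z).2) *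
              (‖Θ Z‖₊ : ℝ≥0∞) ^ 2)) := by
  rw [E2half_eq]
  exact lintegral_congr fun Z => integrand_half_eq v L Θ Z

end LowerFrame

/-! ### The registered stub -/

/-- S6a — **energy ordering of the half-swap frames (lower frame)**: for every repulsive finite-range
`v` (hard cores included), every `n`, `L` and every `Θ` in the absolute admissible class of the
two-copy torus, `2 · E₀^per(n+1, L) ≤ E2(½)(Θ)` (`stub_lowerFrame`, registered signature). [folklore] -/
theorem stub_lowerFrame :
    ∀ v : ℝ → ℝ≥0∞, IsRepulsiveFiniteRange v → ∀ (n : ℕ) (L : ℝ) (Θ : Config (n + 1) × Config (n + 1) → ℂ),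
      TwoCopyTorus.Adm0 n L Θ → 2 * periodicGroundStateEnergy v (n + 1) L ≤ TwoCopyTorus.E2half v n L Θ := by
  intro v hv n L Θ hΘ
  have hdiff : Differentiable ℝ Θ := hΘ.1.differentiable one_ne_zero
  -- the two `E2(0)` lower bounds: for `Θ` and for `Θ ∘ F ∈ Adm0`
  have hA : 2 * periodicGroundStateEnergy v (n + 1) L ≤ TwoCopyTorus.E2zero v n L Θ :=
    TwoCopyTorus.productLower v hv n L Θ hΘ
  have hB : 2 * periodicGroundStateEnergy v (n + 1) L ≤
      TwoCopyTorus.E2zero v n L (fun W => Θ (TwoCopyTorus.swapF n W)) :=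
    TwoCopyTorus.productLower v hv n L _ (TwoCopyTorus.swapInvariance v hv n L Θ hΘ).1
  calc 2 * periodicGroundStateEnergy v (n + 1) L
      = 2⁻¹ * (2 * periodicGroundStateEnergy v (n + 1) L) +
          2⁻¹ * (2 * periodicGroundStateEnergy v (n + 1) L) :=
        (LowerFrame.inv_two_mul_add_self _).symm
    _ ≤ 2⁻¹ * TwoCopyTorus.E2zero v n L Θ +
          2⁻¹ * TwoCopyTorus.E2zero v n L (fun W => Θ (TwoCopyTorus.swapF n W)) := by
        gcongr
    _ = 2⁻¹ * (∫⁻ Z in TwoCopyTorus.cell2 n L, (TwoCopyTorus.kinetic2 n Θ Z +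
            (periodicInteraction v L Z.1 + periodicInteraction v L Z.2) * (‖Θ Z‖₊ : ℝ≥0∞) ^ 2)) +
          2⁻¹ * ∫⁻ Z in TwoCopyTorus.cell2 n L, (TwoCopyTorus.kinetic2 n Θ Z +
            (periodicInteraction v L (TwoCopyTorus.swapF n Z).1 +
                periodicInteraction v L (TwoCopyTorus.swapF n Z).2) * (‖Θ Z‖₊ : ℝ≥0∞) ^ 2) := by
        rw [LowerFrame.E2zero_comp_swap v L hdiff]
        rfl
    _ = (∫⁻ Z in TwoCopyTorus.cell2 n L, 2⁻¹ * (TwoCopyTorus.kinetic2 n Θ Z +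
            (periodicInteraction v L Z.1 + periodicInteraction v L Z.2) * (‖Θ Z‖₊ : ℝ≥0∞) ^ 2)) +
          ∫⁻ Z in TwoCopyTorus.cell2 n L, 2⁻¹ * (TwoCopyTorus.kinetic2 n Θ Z +
            (periodicInteraction v L (TwoCopyTorus.swapF n Z).1 +
                periodicInteraction v L (TwoCopyTorus.swapF n Z).2) * (‖Θ Z‖₊ : ℝ≥0∞) ^ 2) := by
        rw [lintegral_const_mul' _ _ LowerFrame.two_inv_ne_top,
          lintegral_const_mul' _ _ LowerFrame.two_inv_ne_top]
    _ ≤ ∫⁻ Z in TwoCopyTorus.cell2 n L,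
          (2⁻¹ * (TwoCopyTorus.kinetic2 n Θ Z +
              (periodicInteraction v L Z.1 + periodicInteraction v L Z.2) * (‖Θ Z‖₊ : ℝ≥0∞) ^ 2) +
            2⁻¹ * (TwoCopyTorus.kinetic2 n Θ Z +
              (periodicInteraction v L (TwoCopyTorus.swapF n Z).1 +
                  periodicInteraction v L (TwoCopyTorus.swapF n Z).2) * (‖Θ Z‖₊ : ℝ≥0∞) ^ 2)) :=
        le_lintegral_add _ _
    _ = TwoCopyTorus.E2half v n L Θ := (LowerFrame.E2half_eq_lintegral_avg v L Θ).symm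

end Summit.AtomisticToContinuum.BoseEinsteinCondensation.Cruxes.TorusHalfSwapOverlap.Birth

end
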